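import Summits.Parity.GeneralizedHardyLittlewood.Theses.GoldbachHeathBrownDispersion
import Literature.NumberTheory.Sieve.CubicBoxModelDispersion
import HarnessLib

/-!
# Route `GoldbachHeathBrownDispersion` — crux `ModelDispersion` (stmt-Parity-19917)

The crux `ModelDispersion` (the dispersion / variance bound
`V = ∑_{N<n≤2N} (∑_k (u − ũ)(k) g(n − k))² ≤ δ U² N + C N M²` with `c`-free class threshold `Q₀(κ, δ)`)
is, verbatim, the Literature kernel theorem
`Literature.NumberTheory.Sieve.CubicMinorant.boxModel_dispersion`
(file `Literature/NumberTheory/Sieve/CubicBoxModelDispersion.lean`, cell parity-ideate lit g14,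
p521832): pair correlations of the rough model at level `N^{1/2}`, the class Brun–Titchmarsh bound for
values of `x³ + 2y³` and a Rankin tail.  This file closes the item by name.

References: B. M. Bredikhin, Russian Math. Surveys 20 (1965) (dispersion method)
[doi:10.1070/RM1965v020n02ABEH001170]; H. L. Montgomery, R. C. Vaughan, Acta Arith. 27 (1975)
[MontgomeryVaughan1975]; Halberstam–Richert (1974) [HalberstamRichert1974].
-/

namespace Summit.Parity.GeneralizedHardyLittlewood.Theorems

/-- **`ModelDispersion` holds** (route `GoldbachHeathBrownDispersion`, crux stmt-Parity-19917): for all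
`κ, δ > 0` there is `Q₀` such that for every `c, B > 0` there are `C, N₀` with
`∑_{N<n≤2N} (∑_{k≤N} (hbWeight c N k − ũ k) · roughModel B (2N) (n − k))² ≤ δ U² N + C N M²`
whenever `U ≥ κ η² N` and every class `k ≡ r (mod d)`, `d ≤ Q₀` squarefree, carries `u`-mass within
`M` of `locDensity(d, r) · U`.  Proof: the Literature theorem `CubicMinorant.boxModel_dispersion` is
this statement. -/
theorem goldbachHeathBrownDispersion_modelDispersion_proof :
    Summit.Parity.GeneralizedHardyLittlewood.Theses.GoldbachHeathBrownDispersion.ModelDispersion := by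
  unfold Summit.Parity.GeneralizedHardyLittlewood.Theses.GoldbachHeathBrownDispersion.ModelDispersion
  exact Literature.NumberTheory.Sieve.CubicMinorant.boxModel_dispersion

end Summit.Parity.GeneralizedHardyLittlewood.Theorems
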